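import Literature.MathematicalPhysics.QuantumLattice.HubbardGaugeBoundTTPrime
import Literature.MathematicalPhysics.QuantumLattice.TorusLogDipoleGraph
import Literature.MathematicalPhysics.QuantumLattice.TorusDiagOutwardNeighbours
import Summits.HubbardSuperconductivity.HubbardLadder.Bounds.PairCorrelationEtaLineDipole
import HarnessLib
import HarnessLib.Audit

/-!
# Machine-checked Koma–Tasaki `η`-line for the `t–t'` Hubbard model (bounds.tex Theorem 10′(t′))

HONEST FRAMING: ladder R1–R4 with certified numbers; no claim on H/H₀.

Cell `pub-hubbard`, BOUNDS part (g16). The paper's Theorem 10 states the sharp-exponent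
Koma–Tasaki bound for the `t–t'` Hubbard model on `ℤ²`,
`η_pair(T) ≥ T/(π(|t| + 2|t'|))`, with a Euclidean (harmonic) dipole; the tree's Koma–Tasaki files
and the cell's `PairCorrelationEtaLineDipole.lean` (imported; `t' = 0`, `T ≥ 1.02|t|`) cover
`t' = 0` only. This file machine-checks
the `ℓ^∞`-dipole version for the full grand-canonical `t–t'` model
`H = H_{t,t'}(U) - μN` on the tori `(ℤ/Lℤ)²` (`HubbardNNNHopping.hubbardTorusTT'`): for every real
`t, t', U, μ`, every `β ≥ 0`, every charge `q` with
`f_q := 4q - 16 β(|t| + 2|t'|) q² e^{q²/2} ≥ 0`, every `L ≥ 1` and all sites `x, y`,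

  `|⟨c†_{x↑} c†_{x↓} c_{y↓} c_{y↑}⟩_{β,L}| ≤ 4^{f_q} (dist_∞(x,y) + 1)^{-f_q}`

(`norm_pairCorr_ttPrime_le_rpow_dipole`), whence the node `PairEtaLineDipoleTPrime` — PROVED as
`pairEtaLineDipoleTPrime_holds`: if `β(|t| + 2|t'|) ≤ 99/100`, i.e. `T ≥ 1.02(|t| + 2|t'|)`, there
are `f > 1/4` and `C` with `|G_{β,L}(x,y)| ≤ C (dist+1)^{-f}` uniformly in `L` — no algebraic pair
order with the Nelson–Kosterlitz exponent `η ≤ 1/4` there, for ANY `U` and ANY filling `μ`. For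
`t' = -0.2t` the certified line is `T ≥ 1.43|t|` (paper, Euclidean: `(π/4)·1.4|t| = 1.10|t|`).

Ingredients (all Literature, landed): the two-graph a priori gauge bound with Koma–Tasaki's
printed hopping norm (`HubbardGaugeBoundTTPrime.norm_thermalCorr_pair_le_exp_tt'`); the explicit
`ℓ^∞` logarithmic dipole and its energy on a general finite-range graph
(`TorusLogDipoleGraph`: gain `2qH(ρ)`, energy `≤ 2A q² e^{q²/2} H(ρ)` from the outward-bond count
`N_s ≤ A(s+1)`); the counts `A = 8` for nearest-neighbour bonds (`TorusOutwardNeighbours`) and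
`A = 16` for diagonal bonds (`TorusDiagOutwardNeighbours.sum_card_outward_diag_le`: `N_s ≤ 16s+8`),
which is where the factor `2` of `|t| + 2|t'|` comes from (in the Euclidean version of the paper it is
`|e₁ ± e₂|² = 2`).

References (keys of `lean/references.bib`): KomaTasakiPRL1992 (Theorem, eqs. (5)–(13), note 9);
McBryanSpencer1977; NelsonKosterlitz1977; XuEtAl2024 (the `t–t'` model).
-/

noncomputable section

namespace Summit.HubbardSuperconductivity.HubbardLadder.Bounds

open Matrix Finset NormedSpace
open Literature.MathematicalPhysics.QuantumLattice Literature.Probability.LatticeModels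
open scoped Matrix.Norms.L2Operator ComplexOrder

/-! ### The a priori bound, pulled back to `(ℤ/Lℤ)²` -/

/-- The pair correlation of the grand-canonical `t–t'` model in terms of the creation/annihilation
monomials on the fermionic torus (definitional bookkeeping). -/
theorem thermalCorr_onSitePair_ttPrime_eq (L : ℕ) [NeZero L] (t t' U μ β : ℝ)
    (x y : TorusSite 2 L) :
    (hubbardTorusTT' L t t' U - (μ : ℂ) • totalNumber).thermalCorr β
        (onSitePair x)ᴴ (onSitePair y) =
      (hubbardTorusTT' L t t' U - (μ : ℂ) • totalNumber).thermalCorr β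
        (creation (orb (FermionTorus.ofTorusSite x) 0) *
          creation (orb (FermionTorus.ofTorusSite x) 1))
        (annihilation (orb (FermionTorus.ofTorusSite y) 1) *
          annihilation (orb (FermionTorus.ofTorusSite y) 0)) := by
  rw [onSitePair_conjTranspose]
  rfl

/-- **Koma–Tasaki's a priori bound for the `t–t'` model on the torus** (printed hopping norm): for
every real site function `φ` on `(ℤ/Lℤ)²` and `β ≥ 0`,
`|G_{β,L}(x,y)| ≤ e^{-2(φ_x - φ_y)} exp[β (|t| Σ_{n.n.} + |t'| Σ_{diag}) (cosh(φ_u - φ_v) - 1)]`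
(pull-back of `norm_thermalCorr_pair_le_exp_tt'` along `FermionTorus.toTorusSite`). -/
theorem apriori_ttPrime (L : ℕ) [NeZero L] (t t' U μ β : ℝ) (hβ : 0 ≤ β) (x y : TorusSite 2 L)
    (φ : TorusSite 2 L → ℝ) :
    ‖(hubbardTorusTT' L t t' U - (μ : ℂ) • totalNumber).thermalCorr β
        (onSitePair x)ᴴ (onSitePair y)‖ ≤
      Real.exp (-2 * (φ x - φ y)) * Real.exp (β * (|t| *
          (∑ u : TorusSite 2 L, ∑ v : TorusSite 2 L,
            (if (torusGraph 2 L).Adj u v then (Real.cosh (φ u - φ v) - 1) else 0)) +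
        |t'| * ∑ u : TorusSite 2 L, ∑ v : TorusSite 2 L,
            (if (torusDiagGraph L).Adj u v then (Real.cosh (φ u - φ v) - 1) else 0))) := by
  have key := norm_thermalCorr_pair_le_exp_tt' L t t' U μ hβ
    (fun u => φ (FermionTorus.toTorusSite u)) (FermionTorus.ofTorusSite x)
    (FermionTorus.ofTorusSite y)
  have hsum₁ : (∑ u : FermionTorus 2 L, ∑ v : FermionTorus 2 L,
      if (fermionTorusGraph 2 L).Adj u v then
        (Real.cosh (φ (FermionTorus.toTorusSite u) - φ (FermionTorus.toTorusSite v)) - 1)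
      else 0) =
      ∑ a : TorusSite 2 L, ∑ b : TorusSite 2 L,
        if (torusGraph 2 L).Adj a b then (Real.cosh (φ a - φ b) - 1) else 0 := by
    refine Fintype.sum_equiv FermionTorus.equivTorusSite _ _ fun u => ?_
    refine Fintype.sum_equiv FermionTorus.equivTorusSite _ _ fun v => ?_
    simp [FermionTorus.equivTorusSite]
  have hsum₂ : (∑ u : FermionTorus 2 L, ∑ v : FermionTorus 2 L,
      if (fermionTorusDiagGraph L).Adj u v then
        (Real.cosh (φ (FermionTorus.toTorusSite u) - φ (FermionTorus.toTorusSite v)) - 1)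
      else 0) =
      ∑ a : TorusSite 2 L, ∑ b : TorusSite 2 L,
        if (torusDiagGraph L).Adj a b then (Real.cosh (φ a - φ b) - 1) else 0 := by
    refine Fintype.sum_equiv FermionTorus.equivTorusSite _ _ fun u => ?_
    refine Fintype.sum_equiv FermionTorus.equivTorusSite _ _ fun v => ?_
    simp [FermionTorus.equivTorusSite, fermionTorusDiagGraph_adj]
  simp only [FermionTorus.toTorusSite_ofTorusSite] at key
  rw [hsum₁, hsum₂] at key
  rw [thermalCorr_onSitePair_ttPrime_eq]
  refine Eq.trans_le ?_ (key.trans_eq ?_)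
  · congr!
  · congr!

/-! ### The explicit power law -/

/-- **Dipole bound for the `t–t'` model (bounds.tex Theorem 10′(t′)), machine-checked and explicit.**
For all real `t, t', U, μ`, `β ≥ 0`, every `q` with `f_q = 4q - 16 β(|t| + 2|t'|) q² e^{q²/2} ≥ 0`,
every torus `L ≥ 1` and all sites `x, y`:
`|G_{β,L}(x,y)| ≤ 4^{f_q} (dist_∞(x,y) + 1)^{-f_q}` (dipole `logDipole x y q ρ` of radius
`ρ = ⌊(dist-1)/2⌋`; nearest-neighbour energy `≤ 16 q² e^{q²/2} H(ρ)`, diagonal energy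
`≤ 32 q² e^{q²/2} H(ρ)`; `H(ρ) ≥ log(ρ+1) ≥ log((dist+1)/4)`). With `q = T/(8(|t|+2|t'|))`:
`η_∞(T) = (T/(4(|t|+2|t'|)))(2 - e^{q²/2})`. -/
theorem norm_pairCorr_ttPrime_le_rpow_dipole (L : ℕ) [NeZero L] (t t' U μ β q : ℝ)
    (hβ : 0 ≤ β)
    (hf : 0 ≤ 4 * q - 16 * (β * (|t| + 2 * |t'|)) * (q ^ 2 * Real.exp (q ^ 2 / 2)))
    (x y : TorusSite 2 L) :
    ‖(hubbardTorusTT' L t t' U - (μ : ℂ) • totalNumber).thermalCorr β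
        (onSitePair x)ᴴ (onSitePair y)‖ ≤
      (4 : ℝ) ^ (4 * q - 16 * (β * (|t| + 2 * |t'|)) * (q ^ 2 * Real.exp (q ^ 2 / 2))) *
        ((torusDist x y : ℝ) + 1) ^
          (-(4 * q - 16 * (β * (|t| + 2 * |t'|)) * (q ^ 2 * Real.exp (q ^ 2 / 2)))) := by
  set c : ℝ := q ^ 2 * Real.exp (q ^ 2 / 2) with hc
  set f : ℝ := 4 * q - 16 * (β * (|t| + 2 * |t'|)) * c with hfdef
  have hf0 : 0 ≤ f := hf
  set R : ℕ := torusDist x y with hR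
  have hR1 : (0 : ℝ) < (R : ℝ) + 1 := by positivity
  have h4f : (1 : ℝ) ≤ (4 : ℝ) ^ f := Real.one_le_rpow (by norm_num) hf0
  rcases Nat.eq_zero_or_pos R with hR0 | hRpos
  · -- coincident sites: the bound with `φ = 0` is `1 ≤ 4^f`
    have h0 := apriori_ttPrime L t t' U μ β hβ x y (fun _ => 0)
    simp only [sub_self, mul_zero, Real.cosh_zero, ite_self, sum_const_zero, add_zero,
      Real.exp_zero, mul_one] at h0
    rw [hR0, Nat.cast_zero, zero_add, Real.one_rpow, mul_one]
    exact h0.trans h4f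
  · -- the dipole of radius `ρ = ⌊(R-1)/2⌋`
    set ρ : ℕ := (R - 1) / 2 with hρdef
    have hρR : 2 * ρ + 1 ≤ torusDist x y := by rw [← hR]; omega
    have hgain := logDipole_gain x y q ρ hρR
    have hE₁ := logDipole_energy_torusGraph_le x y q ρ hρR
    have hE₂ : ∑ u : TorusSite 2 L, ∑ v : TorusSite 2 L,
        (if (torusDiagGraph L).Adj u v then
          (Real.cosh (logDipole x y q ρ u - logDipole x y q ρ v) - 1) else 0) ≤
        32 * c * (harmonic ρ : ℝ) := by
      have h := logDipole_energy_le_of_graph (torusDiagGraph L) 16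
        (fun u v huv => torusDist_le_one_of_diagAdj huv)
        (fun u v w => torusDiagGraph_adj_sub_right_iff u v w)
        (fun s => (sum_card_outward_diag_le s).trans (by omega)) x y q ρ hρR
      calc _ ≤ 2 * ((16 : ℕ) : ℝ) * (q ^ 2 * Real.exp (q ^ 2 / 2)) * (harmonic ρ : ℝ) := h
        _ = 32 * c * (harmonic ρ : ℝ) := by rw [hc]; norm_num
    have key := apriori_ttPrime L t t' U μ β hβ x y (logDipole x y q ρ)
    rw [hgain] at key
    have hβt : 0 ≤ β * |t| := by positivity
    have hβt' : 0 ≤ β * |t'| := by positivity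
    have hHρ : Real.log ((ρ : ℝ) + 1) ≤ (harmonic ρ : ℝ) := by
      have := log_add_one_le_harmonic ρ
      push_cast at this
      exact this
    have hρ1 : (0 : ℝ) < (ρ : ℝ) + 1 := by positivity
    have hquarter : ((R : ℝ) + 1) / 4 ≤ (ρ : ℝ) + 1 := by
      have h : R + 1 ≤ 4 * (ρ + 1) := by omega
      have h' : ((R : ℝ) + 1) ≤ 4 * ((ρ : ℝ) + 1) := by exact_mod_cast h
      linarith
    have hquarter0 : (0 : ℝ) < ((R : ℝ) + 1) / 4 := by positivity
    calc ‖(hubbardTorusTT' L t t' U - (μ : ℂ) • totalNumber).thermalCorr β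
            (onSitePair x)ᴴ (onSitePair y)‖
        ≤ Real.exp (-2 * (2 * q * (harmonic ρ : ℝ))) * Real.exp (β * (|t| *
            (∑ u : TorusSite 2 L, ∑ v : TorusSite 2 L,
              (if (torusGraph 2 L).Adj u v then
                (Real.cosh (logDipole x y q ρ u - logDipole x y q ρ v) - 1) else 0)) +
            |t'| * ∑ u : TorusSite 2 L, ∑ v : TorusSite 2 L,
              (if (torusDiagGraph L).Adj u v then
                (Real.cosh (logDipole x y q ρ u - logDipole x y q ρ v) - 1) else 0))) := key
      _ ≤ Real.exp (-2 * (2 * q * (harmonic ρ : ℝ))) *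
            Real.exp (β * (|t| * (16 * c * (harmonic ρ : ℝ)) +
              |t'| * (32 * c * (harmonic ρ : ℝ)))) := by
          gcongr -- side goals `hE₁`, `hE₂` are discharged by `assumption`
      _ = Real.exp (-(f * (harmonic ρ : ℝ))) := by
          rw [← Real.exp_add, hfdef]
          congr 1
          ring
      _ ≤ Real.exp (-(f * Real.log ((ρ : ℝ) + 1))) := by
          gcongr
      _ = ((ρ : ℝ) + 1) ^ (-f) := by
          rw [Real.rpow_def_of_pos hρ1]
          congr 1
          ring
      _ ≤ (((R : ℝ) + 1) / 4) ^ (-f) :=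
          Real.rpow_le_rpow_of_nonpos hquarter0 hquarter (by linarith)
      _ = (4 : ℝ) ^ f * ((R : ℝ) + 1) ^ (-f) := by
          rw [Real.div_rpow hR1.le (by norm_num), Real.rpow_neg (by norm_num : (0:ℝ) ≤ 4),
            div_inv_eq_mul, mul_comm]

/-! ### The machine-checked `η`-line of the `t–t'` model -/

/-- **Cor 10.1‴ (torus form, `t–t'` model; PROVED below).** For the grand-canonical `t–t'` Hubbard
model `H_{t,t'}(U) - μN` on `(ℤ/Lℤ)²` with any real `t, t', U, μ`: if
`β(|t| + 2|t'|) ≤ 99/100` (temperature `T ≥ 1.02(|t| + 2|t'|)`; for `t' = -0.2t`: `T ≥ 1.43|t|`)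
there are an exponent `f > 1/4` and a constant `C` (here `C = 4^f`) with
`|⟨c†_{x↑} c†_{x↓} c_{y↓} c_{y↑}⟩_{β,L}| ≤ C (dist(x,y)+1)^{-f}` for EVERY `L ≥ 1` and all `x, y`
— decay uniformly faster than the Nelson–Kosterlitz borderline `r^{-1/4}`, so no
Kosterlitz–Thouless pair quasi-condensate (`η ≤ 1/4`) there, whatever `U` and the filling.
kind: support (PROVED). Why it might fail: it cannot (proved); NOT claimed: sharpness — the
`ℓ^∞`-method optimum is `T > 1.008(|t| + 2|t'|)`, the paper's Euclidean line (bounds.tex Thm 10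
(iii)) is `T > (π/4)(|t| + 2|t'|)`, and the true `T_BKT` (if any) is far lower. Sources:
KomaTasakiPRL1992 Theorem, eqs. (11)–(13), note 9; McBryanSpencer1977; NelsonKosterlitz1977;
XuEtAl2024 eq. (1); this cell bounds.tex Thm 10 / 10′. -/
@[conjecture] def PairEtaLineDipoleTPrime : Prop :=
  ∀ (t t' U μ β : ℝ), 0 < β → β * (|t| + 2 * |t'|) ≤ 99 / 100 →
    ∃ f C : ℝ, 1 / 4 < f ∧ ∀ (L : ℕ) [NeZero L] (x y : TorusSite 2 L),
      ‖(hubbardTorusTT' L t t' U - (μ : ℂ) • totalNumber).thermalCorr β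
          (onSitePair x)ᴴ (onSitePair y)‖ ≤
        C * ((torusDist x y : ℝ) + 1) ^ (-f)

/-- **`PairEtaLineDipoleTPrime` holds** (witness `q = 1/8`, `C = 4^f`,
`f = 1/2 - β(|t|+2|t'|) e^{1/128}/4 ≥ 1/2 - (99/100)(16513/16384)/4 > 1/4`, with
`e^{1/128} ≤ 16513/16384` from `PairCorrelationEtaLineDipole.exp_inv128_le`). -/
theorem pairEtaLineDipoleTPrime_holds : PairEtaLineDipoleTPrime := by
  intro t t' U μ β hβ hb
  have hE := exp_inv128_le
  have hEpos := Real.exp_pos ((1 / 8 : ℝ) ^ 2 / 2)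
  have hbt : 0 ≤ β * (|t| + 2 * |t'|) := by positivity
  set f : ℝ := 4 * (1 / 8 : ℝ) -
    16 * (β * (|t| + 2 * |t'|)) * ((1 / 8 : ℝ) ^ 2 * Real.exp ((1 / 8 : ℝ) ^ 2 / 2)) with hf
  have hprod : (β * (|t| + 2 * |t'|)) * Real.exp ((1 / 8 : ℝ) ^ 2 / 2) ≤
      (99 / 100) * (16513 / 16384) :=
    mul_le_mul hb hE hEpos.le (by norm_num)
  have hf4 : 1 / 4 < f := by
    rw [hf]
    nlinarith [hprod]
  refine ⟨f, (4 : ℝ) ^ f, hf4, fun L _ x y => ?_⟩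
  exact norm_pairCorr_ttPrime_le_rpow_dipole L t t' U μ β (1 / 8) hβ.le (by linarith) x y

end Summit.HubbardSuperconductivity.HubbardLadder.Bounds
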